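import Summits.CriticalPhenomena.SAWScalingLimit.Theorems.SAWDefectDecoherenceObservableToSLERCarvedReductionSqueezeFrame
import Literature.Probability.RandomPlanarGeometry.RestrictionZeroOne
import HarnessLib

/-!
# The restriction datum of the final pair `(E_{n₀}, M')`: clauses (φE, Φ, d, 1 - ε' < d^{5/8})
# (piece (T-A′₂ datum) of stub T-A′₂ `stub_carvedReduction_squeezeGeometry_domainsCore`)

Crux `SAWDevelopingMap.ObservableToSLE` (stmt-CriticalPhenomena-10472), line `six-class-type-ladder`,
stub T-A′₂ `stub_carvedReduction_squeezeGeometry_domainsCore`.  Landing target: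
`Summits/CriticalPhenomena/SAWScalingLimit/Theorems/SAWDevelopingMapObservableToSLETypeLadderCarvedReductionSqueezeFrameDatum.lean`.

The frame `Squeeze.stub_carvedReduction_derivFrame` (twin, p129409) bounds EVERY restriction datum
of the hull of `M'` pulled back by the uniformizer `φ ∘ Φ'⁻¹` of the outer approximant `E_n`,
for every restriction map `Φ'` of `A_n = φ.pullbackHull E_n` with the right behaviour of `Φ'⁻¹` at
`0` and `∞`.  `frameDatum` EXHIBITS the data in the shape of the STAGE-2 clauses of T-A: for
`n ≥ n₀` and every admissible `M'` there are a chordal uniformizer `φE` of `E_n`, a restriction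
map `Ψ` of `φE.pullbackHull M'` with derivative `d`, and `1 - ε' < d ^ (5/8)`:
`Φ'` exists (`IsStarHull.existsUnique_isRestrictionMap_holds` on the `*`-hull `A_n`,
`IsStarHull.pullbackHull`), `Φ'⁻¹ → 0` at `0` and `→ ∞` at `∞`
(`IsRestrictionMap.tendsto_symm_nhdsWithin_zero`, `IsRestrictionMap.tendsto_symm_cocompact`),
the pulled-back hull of `M'` is a `*`-hull (hull subdomain of `E_n`), so `Ψ` and `d ∈ (0, 1]`
exist (`IsStarHull.exists_hasRestrictionDeriv_holds`), the frame gives `1 - ε'/2 ≤ d`, and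
`d ≤ d ^ (5/8)` for `0 < d ≤ 1`.
Registered carrier: `stub_carvedReduction_frameDatum`.
-/

noncomputable section

open Set Filter Topology Metric Function
open UpperHalfPlane (upperHalfPlaneSet)
open Literature.Probability.RandomPlanarGeometry

namespace Summit.CriticalPhenomena.SAWScalingLimit.Theorems.ObservableToSLE.TypeLadder

open Summit.CriticalPhenomena.SAWScalingLimit.Theorems.ObservableToSLER.Squeeze (stub_carvedReduction_derivFrame)

/-- For `0 < d ≤ 1` with `1 - ε'/2 ≤ d` and `ε' > 0`: `1 - ε' < d ^ (5/8)`. -/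
theorem one_sub_lt_rpow_five_eighths {d ε' : ℝ} (hd0 : 0 < d) (hd1 : d ≤ 1) (hε' : 0 < ε') (hd : 1 - ε' / 2 ≤ d) :
    1 - ε' < d ^ ((5 : ℝ) / 8) := by
  have h1 : d ≤ d ^ ((5 : ℝ) / 8) := by
    have := Real.rpow_le_rpow_of_exponent_ge hd0 hd1 (show (5 : ℝ) / 8 ≤ 1 by norm_num)
    rwa [Real.rpow_one] at this
  linarith

/-- **THE RESTRICTION DATUM OF THE FINAL PAIR.**  Under the hypotheses of the frame
(`Squeeze.stub_carvedReduction_derivFrame`): for every `ε' > 0`, `r' > 0`, `R'` there are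
`δ₀ > 0`, `θ > 0`, `n₀` such that for every `n ≥ n₀` and every hull subdomain `M'` of `E` inside
`E_n` whose hull lies between `A` and `thickHull A δ₀ ∪ {im ≤ θ, r' ≤ ‖·‖ ≤ R'}`, there are a
chordal uniformizer `φE` of `E_n`, for which `M'` is a hull subdomain of `E_n`, a restriction map
`Ψ` of `φE.pullbackHull M'` with restriction derivative `d`, and `1 - ε' < d ^ (5/8)`. -/
theorem frameDatum (E : DobrushinDomain) (φ : ConformalEquiv upperHalfPlaneSet E.carrier) (A : Set ℂ)
    (En : ℕ → DobrushinDomain) (hEn : ∀ n, E.IsHullSubdomain (En n)) (hφ : E.IsChordalUniformizing φ)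
    (hA : IsStarHull A) (hne : A.Nonempty) (hmono : Monotone fun n => φ.pullbackHull (En n))
    (hsub : ∀ n, φ.pullbackHull (En n) ⊆ A)
    (hker : ∀ W : Set ℂ, IsOpen W → IsPreconnected W → W ⊆ ⋂ n, upperHalfPlaneSet \ φ.pullbackHull (En n) →
      (W ∩ (upperHalfPlaneSet \ A)).Nonempty → W ⊆ upperHalfPlaneSet \ A)
    {ε' r' : ℝ} (R' : ℝ) (hε' : 0 < ε') (hr' : 0 < r') :
    ∃ δ₀ > (0 : ℝ), ∃ θ > (0 : ℝ), ∃ n₀ : ℕ, ∀ n, n₀ ≤ n → ∀ (M' : DobrushinDomain), E.IsHullSubdomain M' →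
      M'.carrier ⊆ (En n).carrier → A ⊆ φ.pullbackHull M' →
      φ.pullbackHull M' ⊆ thickHull A δ₀ ∪ {z : ℂ | z.im ≤ θ ∧ r' ≤ ‖z‖ ∧ ‖z‖ ≤ R'} →
      ∃ (φE : ConformalEquiv upperHalfPlaneSet (En n).carrier)
        (Ψ : ConformalEquiv (upperHalfPlaneSet \ φE.pullbackHull M') upperHalfPlaneSet) (d : ℝ),
        (En n).IsChordalUniformizing φE ∧ (En n).IsHullSubdomain M' ∧
        IsRestrictionMap (φE.pullbackHull M') Ψ ∧ HasRestrictionDeriv (φE.pullbackHull M') Ψ d ∧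
        1 - ε' < d ^ ((5 : ℝ) / 8) := by
  have hsc : ∀ D₀ : JordanDomain, D₀.isSimplyConnected := JordanDomain.isSimplyConnected_holds
  obtain ⟨δ₀, hδ₀, θ, hθ, n₀, hmain⟩ :=
    stub_carvedReduction_derivFrame E φ A En hEn hφ hA hne hmono hsub hker (ε' / 2) r' R' (half_pos hε') hr'
  refine ⟨δ₀, hδ₀, θ, hθ, n₀, fun n hn M' hM' hM'En hAH hHt => ?_⟩
  -- a restriction map of the `*`-hull `A_n`, with the behaviour of its inverse at `0` and `∞`
  have hAn : IsStarHull (φ.pullbackHull (En n)) := IsStarHull.pullbackHull hsc hφ (hEn n)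
  obtain ⟨Φ', hΦ', -⟩ := IsStarHull.existsUnique_isRestrictionMap_holds hAn
  have h0 := hΦ'.tendsto_symm_nhdsWithin_zero hAn
  have hinf := hΦ'.tendsto_symm_cocompact hAn
  obtain ⟨hunif, hsubEn, hall⟩ := hmain n hn M' hM' hM'En hAH hHt Φ' hΦ' h0 hinf
  set φE := Φ'.symm.trans (φ.restrHull (En n) (hEn n).carrier_subset) with hφE
  -- the pulled-back hull of `M'` is a `*`-hull: restriction map and derivative
  have hH : IsStarHull (φE.pullbackHull M') := IsStarHull.pullbackHull hsc hunif hsubEn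
  obtain ⟨Ψ, hΨ, -⟩ := IsStarHull.existsUnique_isRestrictionMap_holds hH
  obtain ⟨d, hd0, hd1, hd⟩ := IsStarHull.exists_hasRestrictionDeriv_holds hH hΨ
  exact ⟨φE, Ψ, d, hunif, hsubEn, hΨ, hd, one_sub_lt_rpow_five_eighths hd0 hd1 hε' (hall Ψ d hΨ hd)⟩

/-- **Registered carrier `stub_carvedReduction_frameDatum`** (crux item stmt-CriticalPhenomena-10472,
stub T-A′₂ `stub_carvedReduction_squeezeGeometry_domainsCore`, piece THE RESTRICTION DATUM): the
elementary inequality `1 - ε' < d ^ (5/8)` for `0 < d ≤ 1`, `1 - ε'/2 ≤ d`. -/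
theorem stub_carvedReduction_frameDatum :
    ∀ (d ε' : ℝ), 0 < d → d ≤ 1 → 0 < ε' → 1 - ε' / 2 ≤ d → 1 - ε' < d ^ ((5 : ℝ) / 8) :=
  fun _ _ hd0 hd1 hε' hd => one_sub_lt_rpow_five_eighths hd0 hd1 hε' hd

end Summit.CriticalPhenomena.SAWScalingLimit.Theorems.ObservableToSLE.TypeLadder

end
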